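import Summits.QuantumFields.YangMills.Theorems.LuscherReductionTwistedTraceScalingBOLocalisedAvgFP
import Summits.QuantumFields.YangMills.Theorems.LuscherReductionTwistedTraceScalingBODualProfile
import HarnessLib

/-!
# (C1c'-γ) THE RIDER SANDWICH: `gaugeAvg (χ·R) V` against `R₀·gaugeAvg χ V` when the rider `R` is nearly constant where the weight `χ` lives, and the BO function of record IS `recordChi · rider`
# (lane A of S-BASE, crux `TwistedTraceScaling` stmt-QuantumFields-20203, C4-CORE, the (OD) pen, step (2) of the (C1c') plan, `pub/ym-fleet/ym-luscher-20007-p1/COARSE-DESIGN.md` §28.4)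

After `…BOLocalisedAvgFP` the (C1c') input is the two-sided Gaussian shape of the FULL gauge average `gaugeAvg (boFun χ₀ Ω_G) V`.  The BO function of record factors as
`boFun χ₀ Ω_G = recordChi · R` with the RIDER `R(U) = 𝟙_tube(U)·χ₀(slowMean U)·e^{−q(relLinkVec U)}·𝟙{‖relLinkVec U‖ ≤ r}` (the two gauge Gaussians are the same function `e^{−gaugeCoordSq/δg²}`), so
`gaugeAvg (boFun χ₀ Ω_G) V = ∫ χ(V^g)·R(V^g) dg` is `R(V_s)·N(V)` up to the variation of `R` over the set where `χ(V^·)` is not negligible (`N = gaugeAvg χ`, controlled by (P)).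
* §1 ★ `integral_mul_rider_sandwich` — on a probability space: `0 ≤ a`, `0 ≤ r ≤ R_max`, a set `G₁` with `r ∈ [r₋, r₊]` on `G₁` and `a ≤ τ` off `G₁` ⇒
  `r₋·(∫a − τ) ≤ ∫ a·r ≤ r₊·∫a + R_max·τ` (pointwise comparison; `G₁` need not be measurable);
* §2 ★★ `gaugeAvg_mul_rider_sandwich` — the instance `a = χ(V^·)`, `r = R(V^·)`: `r₋·(gaugeAvg χ V − τ) ≤ gaugeAvg (χ·R) V ≤ r₊·gaugeAvg χ V + R_max·τ`;
* §3 ★★ `boFun_frozenProfile_eq_recordChi_mul_rider` — `boFun χ₀ (frozenProfile q r β) U = recordChi L s K M β U · (𝟙_tube(U)·χ₀(slowMean U)·e^{−q β (relLinkVec U)}·𝟙{‖relLinkVec U‖ ≤ r β})` whenever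
  `supp (boFun χ₀ Ω) ⊆ supp recordChi` (`…BOSupportGeometry.boFun_support_record` supplies this for window amplitudes); `rider_mem_Icc` (`0 ≤ R ≤ C_χ₀`).
What (C1c') still owes after this file (COARSE-DESIGN §28.4): the two properties of `G₁(V) = {g : V^g ∈ fat tube, ‖P_Γ relLinkVec(V^g)‖ ≤ r_g}` — (2a) rider constancy `R(V^g) ∈ e^{±ε}e^{−q(x(V_s))}`
on `G₁` (slice Taylor + `stiffGaussExp_add_of_ker`), (2b) `recordChi(V^g) ≤ e^{−β²r_g²}` off `G₁` (definition of `recordChi`) — then (3) `N(V) ∈ N̄(1±Cδ²)` by (P), (4) ✓/slice part, (5).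
HONEST FRAMING: elementary inequalities for a stub of a child of the CONDITIONAL route R2b1; (C1c') (2a)(2b)(3)(4')(5), (C4), (C5), (B-ST) OPEN; C4-CORE OPEN; not infinite volume, not a gap, not Clay.
-/

set_option autoImplicit false

noncomputable section

open MeasureTheory Filter Topology Real
open scoped BigOperators
open Literature.MathematicalPhysics.QuantumFieldTheory
open Literature.MathematicalPhysics.QuantumLattice

namespace Summit.QuantumFields.YangMills.Theorems.FemtoTransferGap.TwoLattice.ConstTube

open Summit.QuantumFields.YangMills.Theorems.FemtoTransferGap
open Summit.QuantumFields.YangMills.Theorems.FemtoTransferGap.TwoLattice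
open Summit.QuantumFields.YangMills.Theorems.FemtoTransferGap.TwoLattice.Avg
open Summit.QuantumFields.YangMills.Theorems.FemtoTransferGap.TwoLattice.Stiff (LinkSpace)

variable {L : ℕ} [NeZero L]

/-! ## §1 The abstract rider sandwich -/

/-- ★ **Rider sandwich** on a probability space: if `0 ≤ a`, `0 ≤ r ≤ R_max` everywhere, `r₋ ≤ r ≤ r₊` on `G₁` (`0 ≤ r₋`, `0 ≤ r₊`) and `a ≤ τ` off `G₁` (`0 ≤ τ`), and `a`, `a·r` are integrable, then
`r₋·(∫a − τ) ≤ ∫ a·r ≤ r₊·∫a + R_max·τ`. [folklore] -/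
theorem integral_mul_rider_sandwich {α : Type*} [MeasurableSpace α] {μ : Measure α} [IsProbabilityMeasure μ] {a r : α → ℝ} (ha0 : ∀ x, 0 ≤ a x) {Rmax : ℝ} (hRmax : 0 ≤ Rmax)
    (hr0 : ∀ x, 0 ≤ r x) (hrmax : ∀ x, r x ≤ Rmax) (G₁ : Set α) {rlo rhi τ : ℝ} (hrlo : 0 ≤ rlo) (hrhi : 0 ≤ rhi) (hτ : 0 ≤ τ)
    (hG : ∀ x ∈ G₁, rlo ≤ r x ∧ r x ≤ rhi) (hoff : ∀ x, x ∉ G₁ → a x ≤ τ) (hai : Integrable a μ) (hari : Integrable (fun x => a x * r x) μ) :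
    rlo * (∫ x, a x ∂μ - τ) ≤ ∫ x, a x * r x ∂μ ∧ ∫ x, a x * r x ∂μ ≤ rhi * ∫ x, a x ∂μ + Rmax * τ := by
  -- pointwise comparisons
  have hup : ∀ x, a x * r x ≤ rhi * a x + Rmax * τ := fun x => by
    by_cases hx : x ∈ G₁
    · have h1 : a x * r x ≤ a x * rhi := mul_le_mul_of_nonneg_left (hG x hx).2 (ha0 x)
      have h2 : 0 ≤ Rmax * τ := mul_nonneg hRmax hτ
      linarith [mul_comm (a x) rhi]
    · have h1 : a x * r x ≤ τ * Rmax := mul_le_mul (hoff x hx) (hrmax x) (hr0 x) hτ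
      have h2 : 0 ≤ rhi * a x := mul_nonneg hrhi (ha0 x)
      linarith [mul_comm τ Rmax]
  have hlow : ∀ x, rlo * a x - rlo * τ ≤ a x * r x := fun x => by
    by_cases hx : x ∈ G₁
    · have h1 : rlo * a x ≤ a x * r x := by rw [mul_comm]; exact mul_le_mul_of_nonneg_left (hG x hx).1 (ha0 x)
      have h2 : 0 ≤ rlo * τ := mul_nonneg hrlo hτ
      linarith
    · have h1 : rlo * a x ≤ rlo * τ := mul_le_mul_of_nonneg_left (hoff x hx) hrlo
      have h2 : 0 ≤ a x * r x := mul_nonneg (ha0 x) (hr0 x)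
      linarith
  constructor
  · have hint1 : Integrable (fun x => rlo * a x - rlo * τ) μ := (hai.const_mul rlo).sub (integrable_const (rlo * τ))
    have h := integral_mono hint1 hari hlow
    have hI : ∫ x, (rlo * a x - rlo * τ) ∂μ = rlo * ∫ x, a x ∂μ - rlo * τ := by
      rw [integral_sub (hai.const_mul rlo) (integrable_const _), integral_const_mul, integral_const]
      simp only [probReal_univ, smul_eq_mul, one_mul]
    rw [hI] at h
    linarith
  · have hint2 : Integrable (fun x => rhi * a x + Rmax * τ) μ := (hai.const_mul rhi).add (integrable_const (Rmax * τ))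
    have h := integral_mono hari hint2 hup
    have hI : ∫ x, (rhi * a x + Rmax * τ) ∂μ = rhi * ∫ x, a x ∂μ + Rmax * τ := by
      rw [integral_add (hai.const_mul rhi) (integrable_const _), integral_const_mul, integral_const]
      simp only [probReal_univ, smul_eq_mul, one_mul]
    rw [hI] at h
    exact h

/-! ## §2 The gauge-average instance -/

/-- ★★ **Rider sandwich for gauge averages**: for bounded measurable `χ ≥ 0` and `0 ≤ R ≤ R_max` on `SU(2)^E`, a set `G₁` of gauge transformations with `R(V^g) ∈ [r₋, r₊]` on `G₁` and
`χ(V^g) ≤ τ` off `G₁`:  `r₋·(gaugeAvg χ V − τ) ≤ gaugeAvg (χ·R) V ≤ r₊·gaugeAvg χ V + R_max·τ`. [folklore] -/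
theorem gaugeAvg_mul_rider_sandwich {χ R : GaugeConfig 3 L SU2 → ℝ} (hχm : Measurable χ) {Cχ : ℝ} (hCχ : ∀ U, |χ U| ≤ Cχ) (hχ0 : ∀ U, 0 ≤ χ U)
    (hRm : Measurable R) {Rmax : ℝ} (hR0 : ∀ U, 0 ≤ R U) (hRmax : ∀ U, R U ≤ Rmax) (V : GaugeConfig 3 L SU2) (G₁ : Set (Site 3 L → SU2)) {rlo rhi τ : ℝ}
    (hrlo : 0 ≤ rlo) (hrhi : 0 ≤ rhi) (hτ : 0 ≤ τ) (hG : ∀ g ∈ G₁, rlo ≤ R (gaugeTransform g V) ∧ R (gaugeTransform g V) ≤ rhi) (hoff : ∀ g, g ∉ G₁ → χ (gaugeTransform g V) ≤ τ) :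
    rlo * (gaugeAvg χ V - τ) ≤ gaugeAvg (fun U => χ U * R U) V ∧ gaugeAvg (fun U => χ U * R U) V ≤ rhi * gaugeAvg χ V + Rmax * τ := by
  haveI : SecondCountableTopology SU2 := secondCountableTopology_su2
  haveI : IsProbabilityMeasure (gaugeMeasure L) := by unfold gaugeMeasure; infer_instance
  have hact : Measurable fun g : Site 3 L → SU2 => gaugeTransform g V := by
    have h := (measurable_gaugeAction (L := L)).comp (measurable_const.prodMk measurable_id : Measurable fun g : Site 3 L → SU2 => (V, g))
    simpa only [Function.comp_def] using h
  have ham : Measurable fun g : Site 3 L → SU2 => χ (gaugeTransform g V) := hχm.comp hact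
  have hrm : Measurable fun g : Site 3 L → SU2 => R (gaugeTransform g V) := hRm.comp hact
  have hRmax0 : 0 ≤ Rmax := (hR0 V).trans (hRmax V)
  have hai : Integrable (fun g : Site 3 L → SU2 => χ (gaugeTransform g V)) (gaugeMeasure L) := integrable_of_measurable_abs_le _ ham fun g => hCχ _
  have hari : Integrable (fun g : Site 3 L → SU2 => χ (gaugeTransform g V) * R (gaugeTransform g V)) (gaugeMeasure L) :=
    integrable_of_measurable_abs_le _ (ham.mul hrm) (C := Cχ * Rmax) fun g => by
      rw [abs_mul, abs_of_nonneg (hR0 _)]; exact mul_le_mul (hCχ _) (hRmax _) (hR0 _) ((abs_nonneg _).trans (hCχ V))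
  exact integral_mul_rider_sandwich (μ := gaugeMeasure L) (fun g => hχ0 _) hRmax0 (fun g => hR0 _) (fun g => hRmax _) G₁ hrlo hrhi hτ hG hoff hai hari

/-! ## §3 The BO function of record is `recordChi · rider` -/

/-- The rider of record `R(U) = 𝟙_tube(U)·χ₀(slowMean U)·e^{−q(relLinkVec U)}·𝟙{‖relLinkVec U‖ ≤ r}` takes values in `[0, C_χ₀]` for `0 ≤ χ₀ ≤ C_χ₀` and `q ≥ 0`. [folklore] -/
theorem rider_mem_Icc {χ₀ : GaugeConfig 3 1 SU2 → ℝ} {Cχ : ℝ} (hχ0 : ∀ u, 0 ≤ χ₀ u) (hCχ : ∀ u, χ₀ u ≤ Cχ) {q : LinkSpace L → ℝ} (hq0 : ∀ x, 0 ≤ q x) (r : ℝ) (U : GaugeConfig 3 L SU2) :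
    0 ≤ (orthoTubeSet L).indicator (fun _ => (1 : ℝ)) U * (χ₀ (slowMean L U) * (Real.exp (-q (relLinkVec L U)) * (Metric.closedBall (0 : LinkSpace L) r).indicator (fun _ => (1 : ℝ)) (relLinkVec L U))) ∧
      (orthoTubeSet L).indicator (fun _ => (1 : ℝ)) U * (χ₀ (slowMean L U) * (Real.exp (-q (relLinkVec L U)) * (Metric.closedBall (0 : LinkSpace L) r).indicator (fun _ => (1 : ℝ)) (relLinkVec L U))) ≤ Cχ := by
  have hCχ0 : 0 ≤ Cχ := (hχ0 1).trans (hCχ 1)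
  have hind1 : 0 ≤ (orthoTubeSet L).indicator (fun _ => (1 : ℝ)) U ∧ (orthoTubeSet L).indicator (fun _ => (1 : ℝ)) U ≤ 1 := by
    by_cases h : U ∈ orthoTubeSet L
    · rw [Set.indicator_of_mem h]; exact ⟨zero_le_one, le_rfl⟩
    · rw [Set.indicator_of_notMem h]; exact ⟨le_rfl, zero_le_one⟩
  have hind2 : 0 ≤ (Metric.closedBall (0 : LinkSpace L) r).indicator (fun _ => (1 : ℝ)) (relLinkVec L U) ∧ (Metric.closedBall (0 : LinkSpace L) r).indicator (fun _ => (1 : ℝ)) (relLinkVec L U) ≤ 1 := by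
    by_cases h : relLinkVec L U ∈ Metric.closedBall (0 : LinkSpace L) r
    · rw [Set.indicator_of_mem h]; exact ⟨zero_le_one, le_rfl⟩
    · rw [Set.indicator_of_notMem h]; exact ⟨le_rfl, zero_le_one⟩
  have he1 : Real.exp (-q (relLinkVec L U)) ≤ 1 := Real.exp_le_one_iff.2 (neg_nonpos.2 (hq0 _))
  have hE : 0 ≤ Real.exp (-q (relLinkVec L U)) * (Metric.closedBall (0 : LinkSpace L) r).indicator (fun _ => (1 : ℝ)) (relLinkVec L U) ∧
      Real.exp (-q (relLinkVec L U)) * (Metric.closedBall (0 : LinkSpace L) r).indicator (fun _ => (1 : ℝ)) (relLinkVec L U) ≤ 1 := by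
    refine ⟨mul_nonneg (Real.exp_pos _).le hind2.1, ?_⟩
    calc _ ≤ 1 * 1 := mul_le_mul he1 hind2.2 hind2.1 zero_le_one
      _ = 1 := one_mul 1
  refine ⟨mul_nonneg hind1.1 (mul_nonneg (hχ0 _) hE.1), ?_⟩
  calc _ ≤ 1 * (Cχ * 1) := mul_le_mul hind1.2 (mul_le_mul (hCχ _) hE.2 hE.1 hCχ0) (mul_nonneg (hχ0 _) hE.1) zero_le_one
    _ = Cχ := by ring

/-- ★★ **The BO function of record is `recordChi · rider`**: for `Ω = frozenProfile L q r β` (gauge width `powScale 1 β`, the same as `recordChi`), whenever the BO function is supported in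
the support of the record weight, `boFun χ₀ Ω U = recordChi L s K M β U · (𝟙_tube(U)·χ₀(slowMean U)·e^{−q β (relLinkVec U)}·𝟙{‖relLinkVec U‖ ≤ r β})` for every `U`. [cite: Luscher1983, §3] -/
theorem boFun_frozenProfile_eq_recordChi_mul_rider (s K M β : ℝ) (q : ℝ → LinkSpace L → ℝ) (r : ℝ → ℝ) (χ₀ : GaugeConfig 3 1 SU2 → ℝ)
    (hsupp : ∀ U, boFun L χ₀ (frozenProfile L q r β) U ≠ 0 → recordChi L s K M β U ≠ 0) (U : GaugeConfig 3 L SU2) :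
    boFun L χ₀ (frozenProfile L q r β) U = recordChi L s K M β U *
      ((orthoTubeSet L).indicator (fun _ => (1 : ℝ)) U * (χ₀ (slowMean L U) * (Real.exp (-(q β (relLinkVec L U))) *
        (Metric.closedBall (0 : LinkSpace L) (r β)).indicator (fun _ => (1 : ℝ)) (relLinkVec L U)))) := by
  by_cases hU : U ∈ fatTubeRho L (fun β => K * powScale s β) (fun b => M * (K * powScale s b)) β
  · rw [recordChi_eq_indicator_mul, Set.indicator_of_mem hU, one_mul]
    unfold boFun frozenProfile gaugeCoordSq
    ring
  · have hχ : recordChi L s K M β U = 0 := by rw [recordChi_eq_indicator_mul, Set.indicator_of_notMem hU, zero_mul]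
    have hbo : boFun L χ₀ (frozenProfile L q r β) U = 0 := by
      by_contra h; exact hsupp U h hχ
    rw [hbo, hχ, zero_mul]

end Summit.QuantumFields.YangMills.Theorems.FemtoTransferGap.TwoLattice.ConstTube

end
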